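import Summits.QuantumFields.BalabanUV.T4Continuum.Support.GradedWellData
import Summits.QuantumFields.BalabanUV.T4Continuum.Support.GradedSubBlocksRefine

/-!
# T⁴ programme, spine node NE2 (U1a), sub-row Δ1 — THE GRADED WELL, file 3: THE SLICE STRUCTURE
# (means of means across scales, `Q′_GW·Q′_GWᴴ` normalised to `1`, the `avg_grad` intertwiner `Q_GW·∂ = Dg₁·Q′_GW`, the
# `SliceData` of `regionGW`, and «`G_GW = regionGW⁻¹` exists with `‖G_GW‖ ≤ max(2/c, 2g)`» from ONE displayed slice inequality)

Row NE2 OWNER (unit `b2b-balaban-t4-ne2-p1`, gen 16), item O16-c of RULING R47 (journal 2026-08-21 l.25022), on files 1, 1b, 2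
(`Support/GradedSubBlocks` p244783, `Support/GradedSubBlocksRefine`, `Support/GradedWellData`).

 * §1 = file 1b `Support/GradedSubBlocksRefine` (`sum_inSub_refine`: means of means across two scales; `blockOf_eq_of_inSub`).
 * §2 (abstract): **`gaugeP_row_scale`** — Bałaban's projection `P = G′Q′ᴴ(Q′G′²Q′ᴴ)⁻¹Q′G′` ((3.25)) is invariant under an invertible
   re-weighting of the rows of `Q′`; `factor_of_ker` (a matrix killing `ker Q′` factors through `Q′` when `Q′Q′ᴴ = 1`).
 * §3 (the graded well): the NORMALISED scalar rows `QsGWn = √(s_i^d)·Q′_{s_i}` with **`QsGWn_mul_conjTranspose : QsGWn·QsGWnᴴ = 1`**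
   (rows of one scale: file 1; rows of different scales: disjoint unit blocks), `regionGW_eq_normalised` (the faithful operator may be
   read with `QsGWn`); **`QvGW_gradT_mulVec_of_ker`**: `Q′_GWλ = 0 → Q_GW(∂λ) = 0` given `layer ≤ m` (file 1's intertwiner at scale
   `s_i` + §1's means of means: both endpoint blocks of a layer-`i` contour lie in layers `i′ ≥ i`, and their scale-`s_i` means are
   averages of the vanishing scale-`s_{i′}` means); hence **`avg_grad_GW : QvGW·gradT = Dg₁GW·QsGWn`**; **`sliceData_GW`**; and the ENDs
   **`coercive_regionGW_of_slice`**, **`opNorm_inv_regionGW_le_of_slice (hS : SliceCoercive … c) (hg : ‖G′_GW‖ ≤ g) : ‖regionGW⁻¹‖ ≤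
   (min (c/2) (1/(2g)))⁻¹`** — «G_GW exists» modulo (GW-W1) and the scalar bound, exactly the shape of `RegionGaugeFixedVector` §3.

HONEST FRAMING (T4-DAG p. 1).  [folklore] bookkeeping at model level (`U = 1`, one layer map on unit blocks, `m` fixed, finite torus);
the slice inequality and the scalar data bounds are DISPLAYED; no two-level law here; NE2 (U1a) NOT proved; spine PROVED 0/9 unchanged;
NOT [B9] (3.16)/(3.23)–(3.27) as printed; NOT infinite volume / mass gap / Clay.  HONEST DEPENDENCY: continuum YM on T⁴ ⇐ BetaPertH ∧ nine
spine estimates (0/9 proved); BetaPertH ⇐ (D1) ∧ (D4) ∧ CAP+tail; G-an2-4 gates asym, D1 and NE2/3/4.  No `sorry`.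
-/

noncomputable section

open scoped BigOperators ComplexConjugate Matrix Matrix.Norms.L2Operator
open Finset

namespace Summit.QuantumFields.BalabanUV.T4Continuum.GradedWellSlice

open Literature.MathematicalPhysics.QuantumFieldTheory.Balaban1983to89.B5Prop11Plancherel (Tor fine unitVec)
open Literature.MathematicalPhysics.QuantumFieldTheory.Balaban1983to89.B5Prop11Lower (nsq nsq_nonneg)
open Literature.MathematicalPhysics.QuantumFieldTheory.Balaban1983to89.B5Block118 (tstep)
open Literature.MathematicalPhysics.QuantumFieldTheory.Balaban1983to89.B5Blocks16 (blockOf)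
open Literature.MathematicalPhysics.QuantumFieldTheory.Balaban1983to89.B5Action121 (GradOp)
open Literature.MathematicalPhysics.QuantumFieldTheory.Balaban1983to89.B5G183RateUnitTower (lev lev_neZero)
open Summit.QuantumFields.BalabanUV.T4Continuum
open Summit.QuantumFields.BalabanUV.T4Continuum.SubtypeCompression (Coercive isUnit_det_of_coercive opNorm_inv_le_of_coercive)
open Summit.QuantumFields.BalabanUV.T4Continuum.RegionGaugeProjection (gramK gaugeP gaugeR isUnit_det_gramK)
open Summit.QuantumFields.BalabanUV.T4Continuum.RegionGaugeSlice (gaugeFixed SliceData SliceCoercive coercive_gaugeFixed_of_slice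
  isUnit_det_gaugeFixed_of_slice opNorm_inv_gaugeFixed_le_of_slice)
open Summit.QuantumFields.BalabanUV.T4Continuum.GradedSubBlocks (Anchor Anc InSub site meanS avgS shiftAnc s_pos sum_inSub
  anchor_eq_of_inSub meanS_mulVec avgS_GradOp_mulVec sum_offsets_one)
open Summit.QuantumFields.BalabanUV.T4Continuum.GradedWellData
open Summit.QuantumFields.BalabanUV.T4Continuum.GradedSubBlocksRefine (sum_inSub_refine blockOf_eq_of_inSub)

variable {d : ℕ}

/-! ## §2 Abstract: row re-weighting invariance of Bałaban's projection; factoring through `Q′` -/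

section Abstract

variable {m u : Type*} [Fintype m] [DecidableEq m] [Fintype u] [DecidableEq u]

omit [DecidableEq m] in
/-- **ROW RE-WEIGHTING INVARIANCE OF (3.25)**: `P(G′, S·Q′) = P(G′, Q′)` for every invertible `S` — the projection onto
`range(G′Q′ᴴ)` only sees the row SPACE of `Q′`. [cite: Balaban1985BackgroundPropagators, (3.25) p.394 (shape)] [folklore] -/
theorem gaugeP_row_scale (G : Matrix m m ℂ) (Q : Matrix u m ℂ) (S : Matrix u u ℂ) (hS : IsUnit S.det) :
    gaugeP G (S * Q) = gaugeP G Q := by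
  have hSh : IsUnit Sᴴ.det := by
    rw [Matrix.det_conjTranspose]; exact hS.star
  unfold gaugeP gramK
  rw [Matrix.conjTranspose_mul]
  have hK : S * Q * G * G * (Qᴴ * Sᴴ) = S * ((Q * G * G * Qᴴ) * Sᴴ) := by simp only [Matrix.mul_assoc]
  rw [hK, Matrix.mul_inv_rev, Matrix.mul_inv_rev]
  calc G * (Qᴴ * Sᴴ) * (Sᴴ⁻¹ * (Q * G * G * Qᴴ)⁻¹ * S⁻¹) * (S * Q) * G
      = G * Qᴴ * (Sᴴ * Sᴴ⁻¹) * (Q * G * G * Qᴴ)⁻¹ * (S⁻¹ * S) * Q * G := by simp only [Matrix.mul_assoc]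
    _ = G * Qᴴ * (Q * G * G * Qᴴ)⁻¹ * Q * G := by
      rw [Matrix.mul_nonsing_inv _ hSh, Matrix.nonsing_inv_mul _ hS, Matrix.mul_one, Matrix.mul_one]

/-- a matrix killing `ker Q′` factors through `Q′` when `Q′Q′ᴴ = 1`: `T = (T·Q′ᴴ)·Q′`. [folklore] -/
theorem factor_of_ker {v : Type*} [Fintype v] (T : Matrix v m ℂ) (Q : Matrix u m ℂ) (hQ : Q * Qᴴ = 1)
    (hker : ∀ lam : m → ℂ, Q *ᵥ lam = 0 → T *ᵥ lam = 0) : T = T * Qᴴ * Q := by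
  have key : ∀ lam : m → ℂ, T *ᵥ lam = (T * Qᴴ * Q) *ᵥ lam := by
    intro lam
    have h1 : Q *ᵥ (lam - Qᴴ *ᵥ (Q *ᵥ lam)) = 0 := by
      rw [Matrix.mulVec_sub, Matrix.mulVec_mulVec, hQ, Matrix.one_mulVec, sub_self]
    have h2 := hker _ h1
    rw [Matrix.mulVec_sub, sub_eq_zero, Matrix.mulVec_mulVec] at h2
    rw [h2, Matrix.mulVec_mulVec]
  funext i j
  have h := congrFun (key (Pi.single j 1)) i
  simpa [Matrix.mulVec, dotProduct, Pi.single_apply] using h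

end Abstract

/-! ## §3 The graded well: normalised rows, the intertwiner on `N(Q′_GW)`, `SliceData`, «G_GW exists» -/

section GW

variable (L : ℕ) [NeZero L] (M : Fin d → ℕ) [hM : ∀ μ, NeZero (M μ)] (k m : ℕ) (layer : Tor M → ℕ) (a a' : ℝ)

/-- the NORMALISED scalar rows `√(s_i^d)·Q′_{s_i}` (so that `QsGWn·QsGWnᴴ = 1`). [folklore] -/
def QsGWn : Matrix (RowS L M k m layer) (TorK L M k) ℂ :=
  fun p y => ((Real.sqrt ((((sGW L k p.1.1 : ℕ) : ℝ)) ^ d) : ℝ) : ℂ) * QsGW L M k m layer p y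

/-- the diagonal of normalising factors. [folklore] -/
def normS : Matrix (RowS L M k m layer) (RowS L M k m layer) ℂ :=
  Matrix.diagonal fun p => ((Real.sqrt ((((sGW L k p.1.1 : ℕ) : ℝ)) ^ d) : ℝ) : ℂ)

/-- `QsGWn = normS·QsGW`. [folklore] -/
theorem QsGWn_eq : QsGWn L M k m layer = normS L M k m layer * QsGW L M k m layer := by
  funext p y
  simp only [QsGWn, normS, Matrix.diagonal_mul]

/-- the normalising diagonal is invertible. [folklore] -/
theorem isUnit_det_normS : IsUnit (normS L M k m layer).det := by
  unfold normS
  rw [Matrix.det_diagonal]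
  refine isUnit_iff_ne_zero.mpr (Finset.prod_ne_zero_iff.mpr fun p _ => ?_)
  have h : (0 : ℝ) < ((sGW L k p.1.1 : ℕ) : ℝ) ^ d := pow_pos (by exact_mod_cast s_pos (sGW L k p.1.1)) d
  exact_mod_cast (Real.sqrt_pos.mpr h).ne'

/-- **THE FAITHFUL OPERATOR READ WITH NORMALISED ROWS**: `regionGW = gaugeFixed curlT gradT G′_GW QsGWn Q_GW a`. [folklore] -/
theorem regionGW_eq_normalised :
    regionGW L M k m layer a a'
      = gaugeFixed (curlT L M k) (gradT L M k) (GOmGW L M k m layer a') (QsGWn L M k m layer) (QvGW L M k m layer) a := by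
  unfold regionGW gaugeFixed gaugeR
  rw [QsGWn_eq, gaugeP_row_scale _ _ _ (isUnit_det_normS L M k m layer)]

omit [NeZero L] hM in
/-- every scale divides the number of fine sites per unit block: `s_i ∣ n`. [folklore] -/
theorem sGW_dvd_lev (i : ℕ) : sGW L k i ∣ lev L k := by
  show lev L (k - i) ∣ lev L k
  rw [lev_eq_pow, lev_eq_pow]
  exact Nat.pow_dvd_pow L (Nat.sub_le k i)

/-- two scalar rows whose sub-blocks share a site coincide. [folklore] -/
theorem row_eq_of_inSub {p q : RowS L M k m layer} {y : TorK L M k}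
    (hp : InSub (fine (lev L k) M) (sGW L k p.1.1) p.1.2.1 y) (hq : InSub (fine (lev L k) M) (sGW L k q.1.1) q.1.2.1 y) : p = q := by
  obtain ⟨⟨i, z⟩, hpz⟩ := p
  obtain ⟨⟨i', w⟩, hqw⟩ := q
  have hb1 := blockOf_eq_of_inSub (lev L k) M (sGW L k i) (sGW_dvd_lev L k i) hp
  have hb2 := blockOf_eq_of_inSub (lev L k) M (sGW L k i') (sGW_dvd_lev L k i') hq
  have hii : i = i' := by
    apply Fin.ext
    have h1 : layer (blockOf (lev L k) M z.1) = i := hpz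
    have h2 : layer (blockOf (lev L k) M w.1) = i' := hqw
    rw [← h1, ← h2, ← hb1, ← hb2]
  subst hii
  have hzw : z = w := Subtype.ext (anchor_eq_of_inSub (fine (lev L k) M) (sGW L k i) z.2 w.2 fun ν => (hq ν).symm.trans (hp ν))
  subst hzw
  rfl

/-- **`QsGWn·QsGWnᴴ = 1`**: the normalised graded means are ORTHONORMAL (rows of one scale: disjoint sub-blocks of `s_i^d` sites; rows of
different scales: disjoint unit blocks). [cite: Balaban1984PropagatorsI, (1.14) p.19 (shape)] [folklore] -/
theorem QsGWn_mul_conjTranspose : QsGWn L M k m layer * (QsGWn L M k m layer)ᴴ = 1 := by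
  ext p q
  rw [Matrix.mul_apply, Matrix.one_apply]
  by_cases hpq : p = q
  · subst hpq
    rw [if_pos rfl]
    have hsc : (((sGW L k p.1.1 : ℕ) : ℂ) ^ d) ≠ 0 := pow_ne_zero _ (by exact_mod_cast (NeZero.ne (sGW L k p.1.1)))
    have hsq : ((Real.sqrt (((sGW L k p.1.1 : ℕ) : ℝ) ^ d) : ℝ) : ℂ) * ((Real.sqrt (((sGW L k p.1.1 : ℕ) : ℝ) ^ d) : ℝ) : ℂ)
        = ((sGW L k p.1.1 : ℕ) : ℂ) ^ d := by
      rw [← Complex.ofReal_mul, Real.mul_self_sqrt (pow_nonneg (Nat.cast_nonneg _) _)]; push_cast; ring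
    have e1 : ∀ y, QsGWn L M k m layer p y * (QsGWn L M k m layer)ᴴ y p
        = if InSub (fine (lev L k) M) (sGW L k p.1.1) p.1.2.1 y then ((((sGW L k p.1.1 : ℕ) : ℂ) ^ d)⁻¹) else 0 := by
      intro y
      rw [Matrix.conjTranspose_apply]
      simp only [QsGWn, QsGW, meanS]
      by_cases hy : InSub (fine (lev L k) M) (sGW L k p.1.1) p.1.2.1 y
      · rw [if_pos hy, Complex.star_def, map_mul, map_inv₀, map_pow, Complex.conj_ofReal, Complex.conj_natCast,
          mul_mul_mul_comm, hsq]
        field_simp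
      · rw [if_neg hy, mul_zero, zero_mul]
    rw [Finset.sum_congr rfl fun y _ => e1 y, sum_inSub (fine (lev L k) M) (sGW L k p.1.1) (sGW_dvd L M k p.1.1) p.1.2.2,
      Finset.sum_const, Finset.card_univ, Fintype.card_fun, Fintype.card_fin, Fintype.card_fin, nsmul_eq_mul]
    push_cast
    field_simp
  · rw [if_neg hpq]
    refine Finset.sum_eq_zero fun y _ => ?_
    rw [Matrix.conjTranspose_apply]
    simp only [QsGWn, QsGW, meanS]
    by_cases hy : InSub (fine (lev L k) M) (sGW L k p.1.1) p.1.2.1 y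
    · have hy' : ¬ InSub (fine (lev L k) M) (sGW L k q.1.1) q.1.2.1 y := fun h => hpq (row_eq_of_inSub L M k m layer hy h)
      rw [if_neg hy', mul_zero, star_zero, mul_zero]
    · rw [if_neg hy, mul_zero, zero_mul]

omit [NeZero L] hM in
/-- finer scales divide coarser ones: `i ≤ i′ → s_{i′} ∣ s_i`. [folklore] -/
theorem sGW_dvd_sGW {i i' : ℕ} (h : i ≤ i') : sGW L k i' ∣ sGW L k i := by
  show lev L (k - i') ∣ lev L (k - i)
  rw [lev_eq_pow, lev_eq_pow]
  exact Nat.pow_dvd_pow L (by omega)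

/-- **MEANS OF MEANS ON `N(Q′_GW)`**: if every graded mean of `λ` vanishes and `layer ≤ m`, then the scale-`s_i` mean of `λ` over
the sub-block of ANY scale-`s_i` anchor whose unit block lies in a layer `i′ ≥ i` vanishes. [cite: Balaban1984PropagatorsII, (2.7) p.225 (shape)] [folklore] -/
theorem meanS_mulVec_eq_zero_of_ker (hlay : ∀ y, layer y ≤ m) (lam : TorK L M k → ℂ)
    (hker : QsGW L M k m layer *ᵥ lam = 0) {i : ℕ} (z : Anc (fine (lev L k) M) (sGW L k i))
    (hi : i ≤ layer (blockOf (lev L k) M z.1)) :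
    (meanS (fine (lev L k) M) (sGW L k i) *ᵥ lam) z = 0 := by
  set i' := layer (blockOf (lev L k) M z.1) with hi'
  have hi'm : i' ≤ m := hlay _
  have hts : sGW L k i' ∣ sGW L k i := sGW_dvd_sGW L k hi
  simp only [Matrix.mulVec, dotProduct, meanS]
  have e0 : ∑ y, (if InSub (fine (lev L k) M) (sGW L k i) z.1 y then (((sGW L k i : ℕ) : ℂ) ^ d)⁻¹ else 0) * lam y
      = (((sGW L k i : ℕ) : ℂ) ^ d)⁻¹ * ∑ y, (if InSub (fine (lev L k) M) (sGW L k i) z.1 y then lam y else 0) := by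
    rw [Finset.mul_sum]
    refine Finset.sum_congr rfl fun y _ => ?_
    split_ifs <;> simp
  rw [e0, sum_inSub_refine (fine (lev L k) M) (sGW L k i) (sGW L k i') hts z.1 lam]
  suffices h : ∀ w : Anc (fine (lev L k) M) (sGW L k i'), InSub (fine (lev L k) M) (sGW L k i) z.1 w.1 →
      ∑ y, (if InSub (fine (lev L k) M) (sGW L k i') w.1 y then lam y else 0) = 0 by
    rw [Finset.sum_eq_zero fun w _ => ?_, mul_zero]
    split_ifs with hw
    · exact h w hw
    · rfl
  intro w hw
  -- `w`'s unit block is `z`'s, so `(i′, w)` is a scalar row, and its (vanishing) graded mean is this sum up to `s_{i′}^{−d}`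
  have hb : blockOf (lev L k) M w.1 = blockOf (lev L k) M z.1 :=
    blockOf_eq_of_inSub (lev L k) M (sGW L k i) (sGW_dvd_lev L k i) hw
  let q : RowS L M k m layer := ⟨⟨⟨i', Nat.lt_succ_of_le hi'm⟩, w⟩, by simp [hb, hi']⟩
  have hq := congrFun hker q
  simp only [Matrix.mulVec, dotProduct, QsGW, meanS, Pi.zero_apply] at hq
  have e1 : ∑ y, (if InSub (fine (lev L k) M) (sGW L k i') w.1 y then (((sGW L k i' : ℕ) : ℂ) ^ d)⁻¹ else 0) * lam y
      = (((sGW L k i' : ℕ) : ℂ) ^ d)⁻¹ * ∑ y, (if InSub (fine (lev L k) M) (sGW L k i') w.1 y then lam y else 0) := by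
    rw [Finset.mul_sum]
    refine Finset.sum_congr rfl fun y _ => ?_
    split_ifs <;> simp
  have hsc : (((sGW L k i' : ℕ) : ℂ) ^ d)⁻¹ ≠ 0 := inv_ne_zero (pow_ne_zero _ (by exact_mod_cast (NeZero.ne (sGW L k i'))))
  have hq' : (((sGW L k i' : ℕ) : ℂ) ^ d)⁻¹ * ∑ y, (if InSub (fine (lev L k) M) (sGW L k i') w.1 y then lam y else 0) = 0 := by
    rw [← e1]; exact hq
  exact (mul_eq_zero.mp hq').resolve_left hsc

/-- **THE GRADED VECTOR AVERAGE KILLS THE GRADIENTS OF `N(Q′_GW)`**: `Q′_GWλ = 0 → Q_GW(∂λ) = 0` (given `layer ≤ m`): a layer-`i`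
contour has both endpoint blocks in layers `≥ i` (the `st`-convention), so file 1's intertwiner and the means of means apply.
[cite: Balaban1984PropagatorsI, (1.55) p.27; Balaban1984PropagatorsII, (2.7) p.225 (shape)] [folklore] -/
theorem QvGW_gradT_mulVec_of_ker (hlay : ∀ y, layer y ≤ m) (lam : TorK L M k → ℂ) (hker : QsGW L M k m layer *ᵥ lam = 0) :
    QvGW L M k m layer *ᵥ (gradT L M k *ᵥ lam) = 0 := by
  funext p
  obtain ⟨⟨i, z, μ⟩, hp⟩ := p
  rw [Pi.zero_apply]
  have e1 : (QvGW L M k m layer *ᵥ (gradT L M k *ᵥ lam)) ⟨⟨i, z, μ⟩, hp⟩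
      = ((wGW L k d i : ℝ) : ℂ) * (avgS (fine (lev L k) M) (sGW L k i) *ᵥ (gradT L M k *ᵥ lam)) (z, μ) := by
    simp only [Matrix.mulVec, dotProduct, QvGW, mul_assoc, ← Finset.mul_sum]
  rw [e1, avgS_GradOp_mulVec (fine (lev L k) M) (sGW L k i) (sGW_dvd L M k i)]
  have hmin : min (layer (blockOf (lev L k) M z.1))
      (layer (blockOf (lev L k) M (shiftAnc (fine (lev L k) M) (sGW L k i) (sGW_dvd L M k i) μ z).1)) = (i : ℕ) := hp
  have h1 : (i : ℕ) ≤ layer (blockOf (lev L k) M z.1) := hmin.symm.le.trans (min_le_left _ _)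
  have h2 : (i : ℕ) ≤ layer (blockOf (lev L k) M (shiftAnc (fine (lev L k) M) (sGW L k i) (sGW_dvd L M k i) μ z).1) :=
    hmin.symm.le.trans (min_le_right _ _)
  rw [meanS_mulVec_eq_zero_of_ker L M k m layer hlay lam hker z h1,
    meanS_mulVec_eq_zero_of_ker L M k m layer hlay lam hker _ h2, sub_self, mul_zero, mul_zero]

/-- the normalised rows have the same kernel. [folklore] -/
theorem QsGW_mulVec_eq_zero_of_normalised {lam : TorK L M k → ℂ} (h : QsGWn L M k m layer *ᵥ lam = 0) :
    QsGW L M k m layer *ᵥ lam = 0 := by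
  funext p
  have hp := congrFun h p
  simp only [Matrix.mulVec, dotProduct, QsGWn, Pi.zero_apply, mul_assoc, ← Finset.mul_sum] at hp ⊢
  have hsc : ((Real.sqrt ((((sGW L k p.1.1 : ℕ) : ℝ)) ^ d) : ℝ) : ℂ) ≠ 0 := by
    have h0 : (0 : ℝ) < ((sGW L k p.1.1 : ℕ) : ℝ) ^ d := pow_pos (by exact_mod_cast s_pos (sGW L k p.1.1)) d
    exact_mod_cast (Real.sqrt_pos.mpr h0).ne'
  exact (mul_eq_zero.mp hp).resolve_left hsc

/-- THE UNIT-LATTICE GRADIENT DATUM `Dg₁GW := Q_GW·∂·QsGWnᴴ` (explicit; equals print's `∂₁` on the layers up to the weights). [folklore] -/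
def Dg1GW : Matrix (RowV L M k m layer) (RowS L M k m layer) ℂ :=
  QvGW L M k m layer * gradT L M k * (QsGWn L M k m layer)ᴴ

/-- **THE `avg_grad` FIELD**: `Q_GW·∂ = Dg₁GW·QsGWn` (given `layer ≤ m`). [cite: Balaban1984PropagatorsI, (1.55) p.27] [folklore] -/
theorem avg_grad_GW (hlay : ∀ y, layer y ≤ m) :
    QvGW L M k m layer * gradT L M k = Dg1GW L M k m layer * QsGWn L M k m layer := by
  unfold Dg1GW
  exact factor_of_ker _ _ (QsGWn_mul_conjTranspose L M k m layer) fun lam h => by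
    rw [← Matrix.mulVec_mulVec]
    exact QvGW_gradT_mulVec_of_ker L M k m layer hlay lam (QsGW_mulVec_eq_zero_of_normalised L M k m layer h)

/-- **THE SLICE DATA OF THE GRADED WELL** (given `layer ≤ m` and `Δ′_GW` invertible). [folklore] -/
theorem sliceData_GW (hlay : ∀ y, layer y ≤ m) (hD : IsUnit (DpGW L M k m layer a').det) (hD0 : 0 < ‖DpGW L M k m layer a'‖) :
    SliceData (curlT L M k) (gradT L M k) (DpGW L M k m layer a') (GOmGW L M k m layer a') (QsGWn L M k m layer)
      (QvGW L M k m layer) (Dg1GW L M k m layer) where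
  curl_grad := curlT_mul_gradT L M k
  avg_grad := avg_grad_GW L M k m layer hlay
  lap_of_ker := fun lam h => lap_of_ker_GW L M k m layer a' lam (QsGW_mulVec_eq_zero_of_normalised L M k m layer h)
  herm := GOmGW_isHermitian L M k m layer a'
  G_mul := Matrix.nonsing_inv_mul _ hD
  mul_G := Matrix.mul_nonsing_inv _ hD
  gram_unit := isUnit_det_gramK _ _ (GOmGW_isHermitian L M k m layer a') (Matrix.mul_nonsing_inv _ hD) hD0 zero_lt_one
    (by rw [QsGWn_mul_conjTranspose, Complex.ofReal_one, one_smul])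

/-- **«`G_GW` EXISTS» FROM ONE SLICE INEQUALITY**: `SliceCoercive … c` (c > 0) and `‖G′_GW‖ ≤ g` ⟹ `regionGW` is coercive with
`γ = min(c/2, 1/(2g))`. [cite: Balaban1985BackgroundPropagators, (3.27) p.395 (shape: existence of G)] [folklore] -/
theorem coercive_regionGW_of_slice (hlay : ∀ y, layer y ≤ m) (hD : IsUnit (DpGW L M k m layer a').det)
    (hD0 : 0 < ‖DpGW L M k m layer a'‖) {c g : ℝ} (hc : 0 < c)
    (hS : SliceCoercive (curlT L M k) (gradT L M k) (GOmGW L M k m layer a') (QsGWn L M k m layer) (QvGW L M k m layer) a c)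
    (hg : ‖GOmGW L M k m layer a'‖ ≤ g) (hg0 : 0 < g) :
    Coercive (regionGW L M k m layer a a') (min (c / 2) (1 / (2 * g))) := by
  rw [regionGW_eq_normalised]
  exact coercive_gaugeFixed_of_slice a (sliceData_GW L M k m layer a' hlay hD hD0) hc hS hg hg0

/-- … hence `regionGW` is invertible … [folklore] -/
theorem isUnit_det_regionGW_of_slice (hlay : ∀ y, layer y ≤ m) (hD : IsUnit (DpGW L M k m layer a').det)
    (hD0 : 0 < ‖DpGW L M k m layer a'‖) {c g : ℝ} (hc : 0 < c)
    (hS : SliceCoercive (curlT L M k) (gradT L M k) (GOmGW L M k m layer a') (QsGWn L M k m layer) (QvGW L M k m layer) a c)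
    (hg : ‖GOmGW L M k m layer a'‖ ≤ g) (hg0 : 0 < g) : IsUnit (regionGW L M k m layer a a').det := by
  rw [regionGW_eq_normalised]
  exact isUnit_det_gaugeFixed_of_slice a (sliceData_GW L M k m layer a' hlay hD hD0) hc hS hg hg0

/-- **… with `‖G_GW‖ ≤ max(2/c, 2g)`**, uniform in everything `c` and `g` are uniform in (the level, the layer map).
[cite: Balaban1985BackgroundPropagators, (3.27) p.395 (shape)] [folklore] -/
theorem opNorm_inv_regionGW_le_of_slice (hlay : ∀ y, layer y ≤ m) (hD : IsUnit (DpGW L M k m layer a').det)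
    (hD0 : 0 < ‖DpGW L M k m layer a'‖) {c g : ℝ} (hc : 0 < c)
    (hS : SliceCoercive (curlT L M k) (gradT L M k) (GOmGW L M k m layer a') (QsGWn L M k m layer) (QvGW L M k m layer) a c)
    (hg : ‖GOmGW L M k m layer a'‖ ≤ g) (hg0 : 0 < g) :
    ‖(regionGW L M k m layer a a')⁻¹‖ ≤ (min (c / 2) (1 / (2 * g)))⁻¹ := by
  rw [regionGW_eq_normalised]
  exact opNorm_inv_gaugeFixed_le_of_slice a (sliceData_GW L M k m layer a' hlay hD hD0) hc hS hg hg0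

end GW

end Summit.QuantumFields.BalabanUV.T4Continuum.GradedWellSlice

end
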